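import Literature.NumberTheory.EllipticCurves.Darmon2004.HeegnerNormCompatibilityInertProofs
import HarnessLib

/-!
# `𝒢_n · HP(n) ⊆ HP(n)`: Galois conjugates over `K` of Heegner points of conductor `n` are Heegner
# points of conductor `n` (Darmon 2004, Thm. 3.7; Gross 1984, §I.1)

Topic `NumberTheory/EllipticCurves` (complex multiplication / Heegner points; sequel of
`Darmon2004/HeegnerNormCompatibilityInertProofs`, `HeegnerPointsOfConductorGaloisOrbitProofs`,
`HeegnerPointsLevelTransport`), namespaces `Literature.NumberTheory.EllipticCurves` (general lemmas)
and `….Darmon2004` (Darmon's set `HP(n) = heegnerPointSet`). THEOREMS ONLY: no definition, no named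
fact (D-0026); net Literature debt `0`.

## What is proved

Darmon, CBMS 101, Thm. 3.7 (PDF p. 44; Shimura reciprocity): *"If `τ` belongs to `CM(𝒪)` and `α`
belongs to `Pic(𝒪)`, then `Φ_N(α ⋆ τ) = rec(α⁻¹) Φ_N(τ)`"* — in particular `Gal(H_n/K) ≅ Pic(𝒪_n)`
maps the set `HP(n) ⊂ E(H_n)` of Heegner points of conductor `n` (§3.4, p. 35) to itself; Gross 1984,
§I.1: `Aut(ℂ/K)` carries a Heegner point `(𝒪, 𝔫, [𝔞])` of `X₀(N)` to a Heegner point `(𝒪, 𝔫, [𝔟])`.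
The tree has this in transport form at conductor `1` (`exists_levelTransport_of_apply_sqrtDisc_eq`) and,
for the PRINCIPAL point `x_β(n)` of conductor `n`, in `HeegnerNormCompatibilityInertProofs` §5
(`exists_mem_heegnerForms_levelTransport_heegnerPointOfConductor`, used inline for `P_n := g • y_n` in
`prop310_inert_of_units` / `prop310_dvd`). This file records the statement for an ARBITRARY Heegner
form / point, as reusable lemmas:

* `exists_levelTransport_of_apply_sqrtDisc_eq_of_discr` — for ANY discriminant `D < 0` with
  `gcd(N, D) = 1`, `4N ∣ β² − D`, `σ ∈ Aut(ℂ)` fixing `√D`, and ANY Heegner form `Q` of level `N`,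
  discriminant `D`, residue `β`: a Heegner form `Q'` (same level, discriminant, residue) with
  `LevelTransport N σ τ_Q τ_{Q'}` (conductor-`1` proof verbatim, the class with residue `β` now by
  `Darmon2004.exists_mem_heegnerForms_formJ_eq`);
* `exists_ringEquiv_extends_of_mem_ringClassGal` — every `g ∈ 𝒢_n = Gal(K[n]/K)` (`ringClassGal`) is
  the restriction of an automorphism of `ℂ` fixing `ι(K)` (countable subfields of `ℂ`:
  `Complex.exists_ringEquiv_apply_eq_of_subfield`);
* `Darmon2004.mem_heegnerPointSet_of_map_eq` — a point of `E(K[n])` over `y_β(n) = φ(x_β(n))` lies in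
  `HP(n)`;
* `Darmon2004.pointGalHom_mem_heegnerPointSet` — **`𝒢_n · HP(n) ⊆ HP(n)`** (`K` imaginary quadratic,
  `gcd(N, d_K) = 1`, `n ≥ 1` prime to `N`): for `y ∈ HP(n)` and `g ∈ 𝒢_n`, `g • y ∈ HP(n)`.

## References

* [Darmon2004] H. Darmon, *Rational Points on Modular Elliptic Curves*, CBMS 101, AMS (2004), §3.4
  Prop. 3.10 and its proof (pp. 35–36; PDF p0045 L36–L69, p0046 L1–L25), Thm. 3.6–3.7 (PDF pp. 43–44).
* [GrossLMS1991] B. H. Gross, *Kolyvagin's work on modular elliptic curves*, LMS LNS 153 (1991), §1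
  (`D ≠ 3, 4`), §3 Prop. 3.7.
* [Gross1984] B. H. Gross, *Heegner points on `X₀(N)`*, in *Modular Forms* (Durham 1983), 1984, §I.1.
* [Cox2013] D. A. Cox, *Primes of the form x² + ny²*, 2nd ed. (2013), §10.C Thm. 10.23 (proof),
  Thm. 11.1.

## Mathlib / tree search

Tree, by name: `heegnerPointSet`, `toComplex` (`Darmon2004/HeegnerNormCompatibility`);
`exists_orientation_of_mem_heegnerForms`, `exists_mem_heegnerForms_formJ_eq`,
`exists_mem_heegnerForms_levelTransport_heegnerPointOfConductor` (`Darmon2004/HeegnerNormCompatibilityInertProofs`);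
`levelTransport_of_transport_lattice_eq`, `exists_levelTransport_of_apply_sqrtDisc_eq`, `sqrtDisc`
(`HeegnerPointsLevelTransport`); `exists_formJ_eq_ringEquiv_apply` (`SingularModuliGaloisStable`);
`isPrimitive_iff_binQF`, `BinQF.isPrimitive_iff`; `Complex.exists_ringEquiv_apply_eq_of_subfield`,
`Subfield.cardinalMk_le_aleph0_of_isAlgebraic` (`FieldTheory/AlgClosed/AutFixedSubfield`);
`ModularParametrizationData.isAutEquivariantOnHeegner`, `apply_sqrtDisc_discr_eq`,
`smul_algebraMap_of_mem_ringClassGal`, `coe_algebraMap_ringClassField`, `isFundamentalDiscriminant_discr`.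
`lean search 'mem_heegnerPointSet|heegnerPointSet ι Dt n'`: the definition and the two `prop310_…`
theorems only — no Galois-stability lemma for `HP(n)` before this file; `lean search
'extends_of_mem_ringClassGal\b'`: only the `ringClassGalOver` version (private, `HeegnerTraceRelationProofs`).
Presearch: [corpus:paper:doi-10-1090-cbms-101 p0044–p0045] (Thm. 3.7, §3.4 `HP(n)`).
-/

noncomputable section

open scoped Classical Cardinal

open NumberField WeierstrassCurve PeriodPair
open Literature.NumberTheory.EllipticCurves.ModularForms
open Literature.NumberTheory.EllipticCurves.RingClassField
open Literature.NumberTheory.QuadraticFields.BinaryQuadraticForm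
open Literature.NumberTheory.QuadraticFields.Quadratic
open Literature.FieldTheory.AlgClosed

namespace Literature.NumberTheory.EllipticCurves

/-! ## §1 `Aut(ℂ/√D)` permutes the Heegner forms of any discriminant `D`, up to level transport -/

/-- **`Aut(ℂ/√D)` permutes the Heegner forms of level `N`, discriminant `D`, residue `β`, up to level
transport** — the tree's conductor-`1` Shimura-reciprocity theorem `exists_levelTransport_of_apply_sqrtDisc_eq`
at an ARBITRARY discriminant `D < 0` with `gcd(N, D) = 1`, `4N ∣ β² − D`: for `σ ∈ Aut(ℂ)` fixing
`√D` and a Heegner form `Q` (level `N`, discriminant `D`, `B ≡ β`), there is a Heegner form `Q'` of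
the same level, discriminant and residue with `LevelTransport N σ τ_Q τ_{Q'}` (`(E_{τ_Q}, C)^σ ≅
(E_{τ_{Q'}}, C')`). Gross 1984 §I.1 / Darmon Thm. 3.7 for the order of discriminant `D`: `Aut(ℂ/K)`
carries a Heegner point `(𝒪, 𝔫, [𝔞])` to a Heegner point `(𝒪, 𝔫, [𝔟])`. Proof: `σ(j(τ_Q)) = j(τ_{Q₁})`
with `disc Q₁ = D` (`exists_formJ_eq_ringEquiv_apply`), `Q₁ ∼ Q'` Heegner with residue `β`
(`Darmon2004.exists_mem_heegnerForms_formJ_eq`), then the engine `levelTransport_of_transport_lattice_eq`.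
[cite: Darmon2004, Thm. 3.7 (PDF p. 44)] [cite: Gross1984, §I.1] -/
theorem exists_levelTransport_of_apply_sqrtDisc_eq_of_discr {N : ℕ} [NeZero N] {D β : ℤ}
    (hD : D < 0) (hND : IsCoprime (N : ℤ) D) (hβD : (4 * N : ℤ) ∣ β ^ 2 - D) {σ : ℂ ≃+* ℂ}
    (hσ : σ (sqrtDisc D) = sqrtDisc D) {Q : ℤ × ℤ × ℤ} (hQ : Q ∈ heegnerForms N D)
    (hβ : Q.2.1 ≡ β [ZMOD 2 * N]) :
    ∃ Q' ∈ heegnerForms N D, Q'.2.1 ≡ β [ZMOD 2 * N] ∧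
      LevelTransport N σ (heegnerTau Q) (heegnerTau Q') := by
  obtain ⟨M, hM⟩ := exists_isTransportedBy σ (ofUpperHalfPlane (heegnerTau Q))
  have hQ' := hQ
  obtain ⟨hdisc, hA, -, hprim⟩ := hQ'
  have hprimQ : IsPrimitive Q := (isPrimitive_iff_binQF Q).mpr ((BinQF.isPrimitive_iff _).mpr hprim)
  have hdiscQ : discr Q = D := hdisc
  obtain ⟨Q₁, hA₁, hprim₁, hdisc₁, hσj⟩ :=
    exists_formJ_eq_ringEquiv_apply hA hprimQ (by rw [hdiscQ]; exact hD) σ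
  obtain ⟨A₁, B₁, C₁⟩ := Q₁
  have hprim₁' : ∀ d : ℤ, d ∣ A₁ → d ∣ B₁ → d ∣ C₁ → IsUnit d :=
    (BinQF.isPrimitive_iff _).mp ((isPrimitive_iff_binQF (A₁, B₁, C₁)).mp hprim₁)
  have hdisc₁' : B₁ ^ 2 - 4 * A₁ * C₁ = D := hdisc₁.trans hdiscQ
  -- a Heegner form with residue `β` in the `SL₂(ℤ)`-class of `Q₁` (the conductor-`n` twin of
  -- `exists_heegnerForm_formJ_eq`, `Darmon2004.exists_mem_heegnerForms_formJ_eq`)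
  obtain ⟨Q', hQ', hβ', hj'⟩ :=
    Darmon2004.exists_mem_heegnerForms_formJ_eq (N := N) hD hβD hA₁ hdisc₁' hprim₁'
  have hjM : (ofUpperHalfPlane (heegnerTau Q')).j = M.j := by
    rw [hM.j_eq, ← formJ_def, ← formJ_def, hσj, hj']
  obtain ⟨c, hc, hMc⟩ := exists_lattice_eq_mulLeft_of_j_eq hjM
  exact ⟨Q', hQ', hβ', levelTransport_of_transport_lattice_eq hD hND hβD hσ hQ hβ hQ' hβ' hM hc hMc⟩

/-! ## §2 Every `g ∈ 𝒢_n = Gal(K[n]/K)` extends to `ℂ` -/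

variable {K : Type} [Field K] [NumberField K]

/-- **Every `g ∈ 𝒢_n = Gal(K[n]/K)` is the restriction of an automorphism of `ℂ` fixing `ι(K)`**
(`K[n] ⊂ ℂ` is countable; embeddings of countable subfields extend to automorphisms of `ℂ` —
transcendence bases, the tree's `Complex.exists_ringEquiv_apply_eq_of_subfield`; Cox, proof of
Thm. 10.23, the `Aut(ℂ)` step). [cite: Cox2013, §10.C proof of Thm. 10.23 (the Aut(ℂ) step)] -/
theorem exists_ringEquiv_extends_of_mem_ringClassGal (hK : IsImaginaryQuadratic K) (ι : K →+* ℂ)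
    {n : ℕ} (hn : n ≠ 0) {g : ringClassField K ι n ≃ₐ[ℚ] ringClassField K ι n}
    (hg : g ∈ ringClassGal ι n) :
    ∃ σ : ℂ ≃+* ℂ, (∀ k : K, σ (ι k) = ι k) ∧
      ∀ x : ringClassField K ι n, σ x = ((g x : ringClassField K ι n) : ℂ) := by
  letI : Algebra K ℂ := ι.toAlgebra
  haveI := (finiteDimensional_and_isGalois_ringClassField hK ι hn).1
  haveI : FiniteDimensional ℚ (ringClassField K ι n) := Module.Finite.trans K (ringClassField K ι n)
  haveI : Algebra.IsAlgebraic ℚ (ringClassField K ι n) := Algebra.IsAlgebraic.of_finite ℚ _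
  have hcard : #(ringClassField K ι n) ≤ ℵ₀ := Subfield.cardinalMk_le_aleph0_of_isAlgebraic _
  obtain ⟨σ, hσ⟩ := Complex.exists_ringEquiv_apply_eq_of_subfield (ringClassField K ι n) hcard
    ((ringClassField K ι n).subtype.comp
      (g : ringClassField K ι n ≃ₐ[ℚ] ringClassField K ι n).toAlgHom.toRingHom)
  have hσx : ∀ x : ringClassField K ι n, σ x = ((g x : ringClassField K ι n) : ℂ) := fun x => by
    simpa using hσ x
  refine ⟨σ, fun k => ?_, hσx⟩
  rw [← coe_algebraMap_ringClassField ι n k, hσx, smul_algebraMap_of_mem_ringClassGal hg k]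

namespace Darmon2004

/-! ## §3 `𝒢_n · HP(n) ⊆ HP(n)` -/

/-- `√(m²D) = m√D`. Private helper (as in the sibling files). [folklore] -/
private theorem sqrtDisc_sq_mul (D : ℤ) (m : ℕ) :
    sqrtDisc ((m : ℤ) ^ 2 * D) = (m : ℂ) * sqrtDisc D := by
  unfold sqrtDisc
  have hm : (0 : ℝ) ≤ m := Nat.cast_nonneg m
  have h : -(((m : ℤ) ^ 2 * D : ℤ) : ℝ) = (m : ℝ) ^ 2 * (-(D : ℝ)) := by push_cast; ring
  rw [h, Real.sqrt_mul (sq_nonneg _), Real.sqrt_sq hm]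
  push_cast
  ring

/-- `4N ∣ (mβ)² − m²D` from `4N ∣ β² − D`. Private helper. [folklore] -/
private theorem dvd_conductor_sq {N : ℕ} {D β : ℤ} (hβ : (4 * N : ℤ) ∣ β ^ 2 - D) (m : ℕ) :
    (4 * N : ℤ) ∣ ((m : ℤ) * β) ^ 2 - (m : ℤ) ^ 2 * D := by
  have h : ((m : ℤ) * β) ^ 2 - (m : ℤ) ^ 2 * D = (m : ℤ) ^ 2 * (β ^ 2 - D) := by ring
  rw [h]
  exact dvd_mul_of_dvd_right hβ _

/-- **The Galois action on `E(K[m])` read in `E(ℂ)`**: if `σ′ ∈ Aut(K[m])` is the restriction of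
`σ ∈ Aut(ℂ)`, then `(σ′ • Z)_ℂ = σ(Z_ℂ)`. Private helper (copy of the sibling file's). [folklore] -/
private theorem toComplex_pointGalHom_eq_map {W : WeierstrassCurve ℚ} (ι : K →+* ℂ) {m : ℕ}
    {σ : ℂ ≃+* ℂ} {σ' : ringClassField K ι m ≃ₐ[ℚ] ringClassField K ι m}
    (hσ' : ∀ x : ringClassField K ι m, ((σ' x : ringClassField K ι m) : ℂ) = σ x)
    (Z : (W.baseChange (ringClassField K ι m)).toAffine.Point) :
    toComplex ι W m (pointGalHom W (ringClassField K ι m) σ' Z) =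
      WeierstrassCurve.Affine.Point.map (W' := W) (σ : ℂ →+* ℂ).toRatAlgHom (toComplex ι W m Z) := by
  rw [toComplex, toComplex, pointGalHom_apply, WeierstrassCurve.Affine.Point.map_map,
    WeierstrassCurve.Affine.Point.map_map]
  exact WeierstrassCurve.Affine.Point.map_congr_fun (fun x ↦ hσ' x) _

/-- **The principal point lies in `HP(n)`**: a point `y ∈ E(K[n])` over `y_β(n) = φ(x_β(n))` belongs
to Darmon's `HP(n)` (its form is Gross's Heegner form of conductor `n`, a Heegner form of level `N`
and discriminant `n²d_K`). [cite: Darmon2004, §3.4 (p. 35), HP(n)] [cite: GrossLMS1991, §3 (the point x_n)] -/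
theorem mem_heegnerPointSet_of_map_eq (hK : IsImaginaryQuadratic K) (ι : K →+* ℂ) {N : ℕ} [NeZero N]
    {W : WeierstrassCurve ℚ} (Dt : ModularParametrizationData W N) {β : ℤ}
    (hβ : (4 * N : ℤ) ∣ β ^ 2 - NumberField.discr K) {n : ℕ} (hn : n ≠ 0)
    {y : (W.baseChange (ringClassField K ι n)).toAffine.Point}
    (hy : toComplex ι W n y = heegnerPointComplexOfConductor Dt (NumberField.discr K) β n) :
    y ∈ heegnerPointSet ι Dt n :=
  ⟨heegnerFormOfConductor (NumberField.discr K) β n,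
    (heegnerFormOfConductor_mem_heegnerForms hK.discr_neg hβ hn).1, hy⟩

/-- **`𝒢_n · HP(n) ⊆ HP(n)`: Galois conjugates over `K` of Heegner points of conductor `n` are Heegner
points of conductor `n`** (Darmon 2004, Thm. 3.7 / Gross 1984, §I.1: `Gal(H_n/K) ≅ Pic(𝒪_n)` acts on
the Heegner points `(𝒪_n, 𝔫, [𝔞])` of `X₀(N)` by `[𝔞] ↦ [𝔞𝔟⁻¹]`). For `K` imaginary quadratic,
`gcd(N, d_K) = 1`, `n ≥ 1` prime to `N`, `y ∈ HP(n)` and `g ∈ 𝒢_n`: `g • y ∈ HP(n)`. Proof: the form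
`Q` of `y` has residue `nβ` for some orientation `β` (`exists_orientation_of_mem_heegnerForms`); `g`
extends to `σ ∈ Aut(ℂ/ι(K))` (`exists_ringEquiv_extends_of_mem_ringClassGal`), which permutes the
Heegner forms of discriminant `n²d_K` and residue `nβ` up to level transport
(`exists_levelTransport_of_apply_sqrtDisc_eq_of_discr`); `φ` is `ℚ`-rational in transport form
(`isAutEquivariantOnHeegner`). [cite: Darmon2004, Thm. 3.7 (PDF p. 44)] [cite: Gross1984, §I.1] -/
theorem pointGalHom_mem_heegnerPointSet (hK : IsImaginaryQuadratic K) (ι : K →+* ℂ) {N : ℕ}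
    [NeZero N] (hND : IsCoprime (N : ℤ) (NumberField.discr K)) {W : WeierstrassCurve ℚ}
    (Dt : ModularParametrizationData W N) {n : ℕ} (hn : n ≠ 0) (hnN : Nat.Coprime n N)
    {y : (W.baseChange (ringClassField K ι n)).toAffine.Point} (hy : y ∈ heegnerPointSet ι Dt n)
    {g : ringClassField K ι n ≃ₐ[ℚ] ringClassField K ι n} (hg : g ∈ ringClassGal ι n) :
    pointGalHom W (ringClassField K ι n) g y ∈ heegnerPointSet ι Dt n := by
  set D : ℤ := NumberField.discr K with hDdef
  have hD : D < 0 := hK.discr_neg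
  have hn0 : (0 : ℤ) < n := by exact_mod_cast Nat.pos_of_ne_zero hn
  have hDn : (n : ℤ) ^ 2 * D < 0 := mul_neg_of_pos_of_neg (pow_pos hn0 2) hD
  obtain ⟨Q, hQ, hyQ⟩ := hy
  have hD4 : D % 4 = 0 ∨ D % 4 = 1 := by
    rcases isFundamentalDiscriminant_discr (K := K) hK.1 with ⟨h1, -⟩ | ⟨h4, -⟩
    · exact Or.inr h1
    · exact Or.inl (Int.emod_eq_zero_of_dvd h4)
  obtain ⟨β, hβ, hQβ⟩ := exists_orientation_of_mem_heegnerForms hD4 hnN hQ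
  obtain ⟨σ, hσK, hσx⟩ := exists_ringEquiv_extends_of_mem_ringClassGal hK ι hn hg
  have hσD : σ (sqrtDisc ((n : ℤ) ^ 2 * D)) = sqrtDisc ((n : ℤ) ^ 2 * D) := by
    rw [sqrtDisc_sq_mul, map_mul, map_natCast, apply_sqrtDisc_discr_eq hK ι hσK]
  have hNDn : IsCoprime (N : ℤ) ((n : ℤ) ^ 2 * D) :=
    IsCoprime.mul_right (IsCoprime.pow_right (Nat.isCoprime_iff_coprime.mpr hnN.symm)) hND
  obtain ⟨Q', hQ', -, hT⟩ := exists_levelTransport_of_apply_sqrtDisc_eq_of_discr hDn hNDn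
    (dvd_conductor_sq hβ n) hσD hQ hQβ
  refine ⟨Q', hQ', ?_⟩
  have hmap : toComplex ι W n (pointGalHom W (ringClassField K ι n) g y) =
      WeierstrassCurve.Affine.Point.map (W' := W) (σ : ℂ →+* ℂ).toRatAlgHom (toComplex ι W n y) :=
    toComplex_pointGalHom_eq_map ι (fun x => (hσx x).symm) y
  change toComplex ι W n (pointGalHom W (ringClassField K ι n) g y) = Dt.φ (heegnerTau Q')
  rw [hmap]
  change toComplex ι W n y = Dt.φ (heegnerTau Q) at hyQ
  rw [hyQ]
  exact Dt.isAutEquivariantOnHeegner _ σ hσD hQ hQ' hT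

end Darmon2004

end Literature.NumberTheory.EllipticCurves

end
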